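import Mathlib

set_option linter.dupNamespace false

/-!
# STUB IDEAS k3-g36 — `stub_heegnerIndexLowerAtTwo` (crux `PrintCf2.SplitBadTwoLowerHalfOfFacts`,
# item stmt-BirchSwinnertonDyer-27851): the SHAPIRO-`v` DICTIONARY R216 DECOMPOSED INTO PROVED GLUE

Seat `sidea-stub_heegnerIndexLowerAtTwo-3-g36` (planner, stub-ideation, k = 3, HOME family 3 «probe the
extremes», assigned technique «decomposition into sub-stubs with a PROVED glue»). `import Mathlib` only;
NO `sorry`, no `instance`, no `notation`, no named fact. Nothing here proves BSD, the crux, or the stub: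
these are typed, kernel-checked GLUE LEMMAS for the one dictionary item the critic's STUB-PLAN v6.8 leaves
between the value identity (R197a′) and the consumed `(2)₂` digit at `v` — **R216 (SHAPIRO-`v`)**: «the
`v`-component of the semi-local `θ_e`-part `∏_{w∣v} U¹(K_{n,w})^{(e)}` IS the one-completion tower
`(A_m = U¹(L_m), t_m = N_{L_{m+1}/L_m}, σ_m)`, factorwise if several primes lie above `v`».

THE DECOMPOSITION (each § is one sub-stub's glue, proved here in the abstract; the typer instantiates):
* §0  tower vocabulary (`IsCoherent`, `invLim`) — IDENTICAL to `ReceptacleLadderK3G35` §0 / port P33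
      (restated only because P33 has not landed; the port imports it, nothing is re-derived: K46).
* §C  COFINAL SHIFT («number of primes above `v` along the tower»): with `2^s` primes above `v` from layer
      `s` on, local layer = global layer − `s`; `invLim t ≃ₗ invLim (n ↦ t (s+n))` by the iterated transition
      `transLE` (built on `Nat.leRecOn`, no index casts), compatible with `σ`.
* §A  PRODUCT TOWERS («factorwise if several primes above `v`»): the five ladder hypotheses
      (INV)(EQV)(PROBE)(F-ONTO)(N-ONTO) pass from the factors to `∏_{w∣v}`; `lim ∏ = ∏ lim`; the
      levelwise `Δ`-coinvariants / anti-invariants of a product are the products (`Submodule.quotientPi`).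
* §B  THE SPLIT-PRIME EXTREME (family 3): a prime `w ∣ v` of `F_m` that SPLITS in `L_m` contributes the
      induced `Δ`-tower `B × B` with `σ` = swap.  There `ker(1+σ) = (1−σ)(B×B)` and `(B×B)^σ = (1+σ)(B×B)`
      EXACTLY (`Ĥ⁻¹ = Ĥ⁰ = 0`), (PROBE) holds with no hypothesis, (F-ONTO)/(N-ONTO) follow from `t` onto,
      and every coherent `σ`-fixed sequence is a `Δ`-norm of a coherent sequence — so the ladder's located
      «×2» (`two_smul_ker_coinvMap`) VANISHES on split factors; one-level Shapiro `(B×B)/(1+σ) ≃ B`,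
      `ker(1+σ) ≃ B`, under which `1−σ` reads as the identity.  (For the class of record every `w ∣ v` is
      NON-split in `L_m = F_m(√u)` — `ℚ₂(√u)/ℚ₂` ramified, `F_{m,w}/ℚ₂` unramified — so §B is the BOUNDARY of
      R216, recorded so that no later card mislocates the «×2»; in the two-variable tower `K₀(E[2^∞])` the
      split case is generic at `𝔭`, since `F_{n,w} ⊇ ℚ₂(√−1, √2, √5)` for large `n`.)
* §D  TRANSPORT: the five hypotheses and `invLim` move along levelwise `σ,t`-compatible linear isomorphisms
      (the typer's iso is `Semilocal.piEquiv`/`unitsEquiv` of `SemilocalPrincipalUnitsPi.lean` + `Additive`).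
* §E  `Coinv χ_u = COINV`: for a group `Υ` acting on `M` THROUGH `{1, σ}` with `χ(υ) = −1` exactly on the
      elements acting as `σ`, the tree's relation module `span {act υ m − χ υ • m}` (`SemilocalUnitData₂.
      coinvRel`) is `range (σ + 1)` — the `Υ`-indexed upgrade of k3-g35's one-operator `span_coinvRel_eq_range`
      (and the located failure mode: an `υ` acting trivially with `χ υ = −1` would add the relation `2m`).
* §F  SHAPIRO FOR THE DIGIT: for the induced functional `L_ind = Σ_w L ∘ c_w ∘ pr_w` on `∏_{w∣v} M`
      (`c_w` the conjugation isomorphisms), `LowerDigit' L_ind ↔ LowerDigit' L` over the SAME scalar ring —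
      both directions by pure algebra, no transitivity needed; `LowerDigit'` is invariant under `≃ₗ`.
      (`LowerDigit'` = k1-g33 / P30's class-free predicate, restated verbatim as in k3-g35; the port imports P30.)
* §G  THE ELLIPTIC-UNITS SNAKE STEP (critic (γ), «S if R197a′ types it so»): the tree's pinned datum is
      `U_∞/𝒞_∞`, not `U_∞`.  Given the ladder's output as HYPOTHESIS (an integral comparison `g : P ↠ E`
      with `(1+σ)P ≤ ker g` and `2 · ker g ≤ (1+σ)P`), for ANY submodule `K ≤ P` (the image of `lim 𝒞̄`):
      `P/((1+σ)P ⊔ K) ↠ E/g(K)` with kernel killed by `2`, and `(P/K)/(1+σ̄)(P/K) ≃ P/((1+σ)P ⊔ K)`.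

HONEST FRAMING.  R216 is TYPING, not mathematics (critic price (α)); this file makes the typing a finite
list of named, proved module lemmas plus ONE instantiation per lemma for the typer (B55 carriers:
`𝒪_{F_n} = 𝕎(𝔽_{2^{2^n}})`, `Λ_v = ℤ₂⟦T⟧`).  It does not touch the value identity R197a′, the class ledger
(KER-2), or any rung of the receptacle ladder (cited, never restated: `range_limMinus_eq`,
`range_coinvMap_eq`, `two_smul_ker_coinvMap`, `lowerDigit_comp_iff`, …).  BSD is NOT proved by any of this.

References: de Shalit 1987 III.1.3 (proof: `𝒰 = Ind_Z^𝒢 𝒰_z`, «Λ is free over Λ_z»; «the norm on principal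
units is surjective» in an unramified step), II.4.1 (2)–(3), II.2.5 (i) (norm relations of elliptic units);
Rubin 1991 §4 p. 36; tree `SemilocalPrincipalUnitsPi.lean` (`Semilocal.piEquiv`), `SemilocalUnitTowerData.lean`
(`SemilocalUnitData₂.coinvRel/Coinv`), Theorems `PrintCf2RubinValueTwoSemilocalUnitDataUnique.lean`
(`exists_linearEquiv_semilocalUnitData₂`, `exists_normCoherent_reps`), `…TowerMorphism.lean`.
-/

namespace Summit.BirchSwinnertonDyer.BirchSwinnertonDyer.Cruxes.SplitBadTwoLowerHalfOfFacts.ShapiroVDictionaryK3G36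

universe u v w

open Function

/-! ## §0 Tower vocabulary (verbatim shape of `ReceptacleLadderK3G35.IsCoherent / invLim`; port imports P33) -/

section Towers

variable {R : Type u} [CommRing R]
variable {A : ℕ → Type v} [∀ m, AddCommGroup (A m)] [∀ m, Module R (A m)]

/-- A norm-coherent sequence of the tower `(A_m, t_m)`: `t_m x_{m+1} = x_m`. -/
def IsCoherent (t : ∀ m, A (m + 1) →ₗ[R] A m) (x : ∀ m, A m) : Prop :=
  ∀ m, t m (x (m + 1)) = x m

/-- The inverse limit `lim_t A_m` as an `R`-submodule of `Π m, A m`. -/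
def invLim (t : ∀ m, A (m + 1) →ₗ[R] A m) : Submodule R (∀ m, A m) where
  carrier := {x | IsCoherent t x}
  add_mem' := by
    intro x y hx hy m
    have hx' : IsCoherent t x := hx
    have hy' : IsCoherent t y := hy
    simp only [Pi.add_apply, map_add, hx' m, hy' m]
  zero_mem' := by
    intro m
    simp
  smul_mem' := by
    intro c x hx m
    have hx' : IsCoherent t x := hx
    simp only [Pi.smul_apply, map_smul, hx' m]

theorem mem_invLim_iff (t : ∀ m, A (m + 1) →ₗ[R] A m) (x : ∀ m, A m) :
    x ∈ invLim t ↔ IsCoherent t x := Iff.rfl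

theorem coherent_of_mem {t : ∀ m, A (m + 1) →ₗ[R] A m} (x : invLim t) :
    IsCoherent t (x : ∀ m, A m) := x.2

end Towers

/-! ## §C Cofinal shift: `lim_m A_m ≃ lim_n A_{s+n}` (local layer = global layer − s)

With `2^s` primes of the tower field above `v` from layer `s` on (each then inert), the `w`-component of
the semi-local units at global layer `s + n` is the LOCAL tower at layer `n`.  The limit does not see the
first `s` layers.  The iterated transition `transLE t (h : m ≤ n) : A n →ₗ A m` is built with
`Nat.leRecOn`, so no cast between `A (s + n + 1)` and `A (s + (n + 1))` is ever needed. -/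

section Shift

variable {R : Type u} [CommRing R]
variable {A : ℕ → Type v} [∀ m, AddCommGroup (A m)] [∀ m, Module R (A m)]
variable (t : ∀ m, A (m + 1) →ₗ[R] A m)

/-- The iterated transition `t_m ∘ t_{m+1} ∘ ⋯ ∘ t_{n-1} : A n → A m` for `m ≤ n`. -/
def transLE {m n : ℕ} (h : m ≤ n) : A n →ₗ[R] A m :=
  Nat.leRecOn (C := fun k => A k →ₗ[R] A m) h (fun {k} (g : A k →ₗ[R] A m) => g ∘ₗ t k) LinearMap.id

theorem transLE_self (m : ℕ) : transLE t (le_refl m) = LinearMap.id :=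
  Nat.leRecOn_self _

theorem transLE_succ {m n : ℕ} (h1 : m ≤ n) (h2 : m ≤ n + 1) :
    transLE t h2 = (transLE t h1) ∘ₗ t n :=
  Nat.leRecOn_succ h1 _

/-- Coherent sequences are pushed down by the iterated transition: `transLE (x n) = x m`. -/
theorem transLE_apply_of_coherent {x : ∀ m, A m} (hx : IsCoherent t x) {m n : ℕ} (h : m ≤ n) :
    transLE t h (x n) = x m := by
  induction n, h using Nat.le_induction with
  | base => rw [transLE_self, LinearMap.id_apply]
  | succ n hmn ih => rw [transLE_succ t hmn, LinearMap.comp_apply, hx n, ih]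

/-- Naturality in the lower index: `t_m ∘ (A n → A (m+1)) = (A n → A m)`. -/
theorem comp_transLE {m n : ℕ} (h : m + 1 ≤ n) (h' : m ≤ n) :
    t m ∘ₗ transLE t h = transLE t h' := by
  induction n, h using Nat.le_induction with
  | base =>
    rw [transLE_self, LinearMap.comp_id, transLE_succ t (le_refl m), transLE_self, LinearMap.id_comp]
  | succ n hmn ih =>
    rw [transLE_succ t hmn, transLE_succ t (Nat.le_of_succ_le hmn), ← LinearMap.comp_assoc,
      ih (Nat.le_of_succ_le hmn)]

/-- A tower map commutes with the iterated transitions (eventual properties descend along the tower). -/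
theorem map_transLE {B : ℕ → Type w} [∀ m, AddCommGroup (B m)] [∀ m, Module R (B m)]
    (tB : ∀ m, B (m + 1) →ₗ[R] B m) (f : ∀ m, A m →ₗ[R] B m)
    (hf : ∀ m a, f m (t m a) = tB m (f (m + 1) a)) {m n : ℕ} (h : m ≤ n) (a : A n) :
    f m (transLE t h a) = transLE tB h (f n a) := by
  induction n, h using Nat.le_induction with
  | base => rw [transLE_self, transLE_self, LinearMap.id_apply, LinearMap.id_apply]
  | succ n hmn ih =>
    rw [transLE_succ t hmn, transLE_succ tB hmn, LinearMap.comp_apply, LinearMap.comp_apply, ih, hf]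

/-- The shifted tower's transitions `n ↦ t_{s+n} : A (s+n+1) → A (s+n)`. -/
def shiftT (s : ℕ) : ∀ n, A (s + n + 1) →ₗ[R] A (s + n) := fun n => t (s + n)

@[simp] theorem shiftT_apply (s n : ℕ) (a : A (s + n + 1)) : shiftT t s n a = t (s + n) a := rfl

/-- Restriction of a coherent sequence to the layers `≥ s`. -/
def restrictShift (s : ℕ) : invLim t →ₗ[R] invLim (A := fun n => A (s + n)) (shiftT t s) where
  toFun x := ⟨fun n => (x : ∀ m, A m) (s + n), fun n => coherent_of_mem x (s + n)⟩
  map_add' _ _ := rfl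
  map_smul' _ _ := rfl

@[simp] theorem restrictShift_apply (s : ℕ) (x : invLim t) (n : ℕ) :
    (restrictShift t s x : ∀ n, A (s + n)) n = (x : ∀ m, A m) (s + n) := rfl

/-- For a coherent sequence of the SHIFTED tower, pushing `y b` down from global layer `s+b` to global
layer `s+a` gives `y a`. -/
theorem transLE_apply_of_coherent_shift (s : ℕ) {y : ∀ n, A (s + n)}
    (hy : IsCoherent (A := fun n => A (s + n)) (shiftT t s) y) {a b : ℕ} (hab : a ≤ b)
    (h : s + a ≤ s + b) : transLE t h (y b) = y a := by
  induction b, hab using Nat.le_induction with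
  | base => rw [transLE_self, LinearMap.id_apply]
  | succ b hb ih =>
    rw [transLE_succ t (Nat.add_le_add_left hb s), LinearMap.comp_apply]
    have : t (s + b) (y (b + 1)) = y b := hy b
    rw [this, ih]

/-- Extension of a coherent sequence given on the layers `≥ s` to ALL layers, by pushing down. -/
def extendShift (s : ℕ) : invLim (A := fun n => A (s + n)) (shiftT t s) →ₗ[R] invLim t where
  toFun y := ⟨fun m => transLE t (Nat.le_add_left m s) ((y : ∀ n, A (s + n)) m), by
    intro m
    have h1 : t m (transLE t (Nat.le_add_left (m + 1) s) ((y : ∀ n, A (s + n)) (m + 1))) =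
        transLE t ((Nat.le_add_left m s).trans (Nat.le_succ _)) ((y : ∀ n, A (s + n)) (m + 1)) := by
      rw [← LinearMap.comp_apply,
        comp_transLE t (Nat.le_add_left (m + 1) s) ((Nat.le_add_left m s).trans (Nat.le_succ _))]
    rw [h1, transLE_succ t (Nat.le_add_left m s), LinearMap.comp_apply]
    have hy : t (s + m) ((y : ∀ n, A (s + n)) (m + 1)) = (y : ∀ n, A (s + n)) m := coherent_of_mem y m
    rw [hy]⟩
  map_add' y y' := by
    apply Subtype.ext
    funext m
    simp only [Submodule.coe_add, Pi.add_apply, map_add]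
  map_smul' c y := by
    apply Subtype.ext
    funext m
    simp only [Submodule.coe_smul, Pi.smul_apply, map_smul, RingHom.id_apply]

@[simp] theorem extendShift_apply (s : ℕ) (y : invLim (A := fun n => A (s + n)) (shiftT t s)) (m : ℕ) :
    (extendShift t s y : ∀ m, A m) m = transLE t (Nat.le_add_left m s) ((y : ∀ n, A (s + n)) m) := rfl

/-- **COFINAL SHIFT.**  `lim_m A_m ≃ₗ lim_n A_{s+n}`: the inverse limit only sees the tail of the tower. -/
def shiftEquiv (s : ℕ) : invLim t ≃ₗ[R] invLim (A := fun n => A (s + n)) (shiftT t s) :=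
  LinearEquiv.ofLinear (restrictShift t s) (extendShift t s)
    (by
      apply LinearMap.ext
      intro y
      apply Subtype.ext
      funext n
      show transLE t (Nat.le_add_left (s + n) s) ((y : ∀ n, A (s + n)) (s + n)) = (y : ∀ n, A (s + n)) n
      exact transLE_apply_of_coherent_shift t s (coherent_of_mem y) (Nat.le_add_left n s) _)
    (by
      apply LinearMap.ext
      intro x
      apply Subtype.ext
      funext m
      show transLE t (Nat.le_add_left m s) ((x : ∀ m, A m) (s + m)) = (x : ∀ m, A m) m
      exact transLE_apply_of_coherent t (coherent_of_mem x) _)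

@[simp] theorem shiftEquiv_apply (s : ℕ) (x : invLim t) (n : ℕ) :
    (shiftEquiv t s x : ∀ n, A (s + n)) n = (x : ∀ m, A m) (s + n) := rfl

/-- On coordinates the inverse is "push down": at the layers `≥ s` it is the identity (so the shift is
compatible with any levelwise operator commuting with `t`, e.g. `σ`). -/
theorem shiftEquiv_symm_apply_add (s : ℕ) (y : invLim (A := fun n => A (s + n)) (shiftT t s)) (n : ℕ) :
    ((shiftEquiv t s).symm y : ∀ m, A m) (s + n) = (y : ∀ n, A (s + n)) n :=
  transLE_apply_of_coherent_shift t s (coherent_of_mem y) (Nat.le_add_left n s) _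

end Shift

/-! ## §A Product towers: «factorwise if several primes lie above `v`»

The semi-local `v`-part at layer `m` is `∏_{w ∣ v} U¹(F_{m,w}(√u))` (tree: `Semilocal.piEquiv`).  When the
decomposition is `σ`-stable factorwise (every `w` non-split in `L_m` — the case of record), the five ladder
hypotheses of `ReceptacleLadderK3G35` §1 hold for the product as soon as they hold for each factor, the
limit of the product is the product of the limits, and the levelwise coinvariants split.  (The index set is
FIXED here; the growth of the number of primes along the tower is absorbed by the cofinal shift §C.) -/

section Product

variable {R : Type u} [CommRing R]
variable {ι : Type w}
variable {A : ι → ℕ → Type v} [∀ i m, AddCommGroup (A i m)] [∀ i m, Module R (A i m)]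
variable (t : ∀ i m, A i (m + 1) →ₗ[R] A i m) (σ : ∀ i m, A i m →ₗ[R] A i m)

/-- Transitions of the product tower `m ↦ Π i, A i m`. -/
def piT (m : ℕ) : (∀ i, A i (m + 1)) →ₗ[R] (∀ i, A i m) :=
  LinearMap.pi fun i => (t i m) ∘ₗ LinearMap.proj i

/-- The factorwise operator `σ` on the product tower. -/
def piS (m : ℕ) : (∀ i, A i m) →ₗ[R] (∀ i, A i m) :=
  LinearMap.pi fun i => (σ i m) ∘ₗ LinearMap.proj i

@[simp] theorem piT_apply (m : ℕ) (a : ∀ i, A i (m + 1)) (i : ι) : piT t m a i = t i m (a i) := rfl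

@[simp] theorem piS_apply (m : ℕ) (a : ∀ i, A i m) (i : ι) : piS σ m a i = σ i m (a i) := rfl

/-- (INV) factorwise ⟹ (INV) for the product. -/
theorem pi_inv (h : ∀ i m a, σ i m (σ i m a) = a) (m : ℕ) (a : ∀ i, A i m) :
    piS σ m (piS σ m a) = a := by
  funext i
  simp only [piS_apply, h]

/-- (EQV) factorwise ⟹ (EQV) for the product. -/
theorem pi_eqv (h : ∀ i m a, t i m (σ i (m + 1) a) = σ i m (t i m a)) (m : ℕ) (a : ∀ i, A i (m + 1)) :
    piT t m (piS σ (m + 1) a) = piS σ m (piT t m a) := by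
  funext i
  simp only [piT_apply, piS_apply, h]

/-- (PROBE) factorwise ⟹ (PROBE) for the product (shape of `ReceptacleLadderK3G35` `hSD`, unfolded). -/
theorem pi_probe
    (h : ∀ i m (a : A i (m + 1)), a + σ i (m + 1) a = 0 → ∃ b : A i m, b - σ i m b = t i m a)
    (m : ℕ) (a : ∀ i, A i (m + 1)) (ha : a + piS σ (m + 1) a = 0) :
    ∃ b : ∀ i, A i m, b - piS σ m b = piT t m a := by
  have hi : ∀ i, ∃ b : A i m, b - σ i m b = t i m (a i) := fun i =>
    h i m (a i) (by simpa using congr_fun ha i)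
  choose b hb using hi
  exact ⟨b, funext fun i => by simpa using hb i⟩

/-- (F-ONTO) factorwise ⟹ (F-ONTO) for the product (shape of `hF`). -/
theorem pi_fonto
    (h : ∀ i m (c : A i m), σ i m c = c → ∃ c' : A i (m + 1), σ i (m + 1) c' = c' ∧ t i m c' = c)
    (m : ℕ) (c : ∀ i, A i m) (hc : piS σ m c = c) :
    ∃ c' : ∀ i, A i (m + 1), piS σ (m + 1) c' = c' ∧ piT t m c' = c := by
  have hi : ∀ i, ∃ c' : A i (m + 1), σ i (m + 1) c' = c' ∧ t i m c' = c i := fun i =>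
    h i m (c i) (by simpa using congr_fun hc i)
  choose c' hc' using hi
  exact ⟨c', funext fun i => by simpa using (hc' i).1, funext fun i => by simpa using (hc' i).2⟩

/-- (N-ONTO) factorwise ⟹ (N-ONTO) for the product (shape of `hT`). -/
theorem pi_nonto (h : ∀ i m, Function.Surjective (t i m)) (m : ℕ) : Function.Surjective (piT t m) := by
  intro c
  have hi : ∀ i, ∃ a : A i (m + 1), t i m a = c i := fun i => h i m (c i)
  choose a ha using hi
  exact ⟨a, funext fun i => by simpa using ha i⟩

/-- `lim_m Π_i A i m ≃ₗ Π_i lim_m A i m` — the identity on coordinates. -/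
def invLimPiEquiv : invLim (A := fun m => ∀ i, A i m) (piT t) ≃ₗ[R] ∀ i, invLim (t i) where
  toFun x := fun i => ⟨fun m => (x : ∀ m, ∀ i, A i m) m i, fun m => congr_fun (coherent_of_mem x m) i⟩
  map_add' _ _ := rfl
  map_smul' _ _ := rfl
  invFun y := ⟨fun m i => (y i : ∀ m, A i m) m, fun m => funext fun i => coherent_of_mem (y i) m⟩
  left_inv _ := rfl
  right_inv _ := rfl

@[simp] theorem invLimPiEquiv_apply (x : invLim (A := fun m => ∀ i, A i m) (piT t)) (i : ι) (m : ℕ) :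
    (invLimPiEquiv t x i : ∀ m, A i m) m = (x : ∀ m, ∀ i, A i m) m i := rfl

/-- Levelwise anti-invariants of the product = product of the anti-invariants. -/
theorem ker_id_add_piS (m : ℕ) :
    LinearMap.ker (LinearMap.id + piS σ m) =
      Submodule.pi Set.univ (fun i => LinearMap.ker (LinearMap.id + σ i m)) := by
  ext a
  simp only [LinearMap.mem_ker, LinearMap.add_apply, LinearMap.id_apply, Submodule.mem_pi,
    Set.mem_univ, true_implies]
  constructor
  · intro ha i
    simpa using congr_fun ha i
  · intro ha
    funext i
    simpa using ha i

/-- Levelwise `Δ`-norm images of the product = product of the images. -/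
theorem range_id_add_piS (m : ℕ) :
    LinearMap.range (LinearMap.id + piS σ m) =
      Submodule.pi Set.univ (fun i => LinearMap.range (LinearMap.id + σ i m)) := by
  ext a
  simp only [LinearMap.mem_range, LinearMap.add_apply, LinearMap.id_apply, Submodule.mem_pi,
    Set.mem_univ, true_implies]
  constructor
  · rintro ⟨b, rfl⟩ i
    exact ⟨b i, by simp⟩
  · intro ha
    choose b hb using ha
    exact ⟨b, funext fun i => by simpa using hb i⟩

/-- Levelwise `Δ`-coinvariants of the product = product of the coinvariants (finitely many primes above `v`). -/
noncomputable def levelCoinvPiEquiv [Fintype ι] [DecidableEq ι] (m : ℕ) :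
    ((∀ i, A i m) ⧸ LinearMap.range (LinearMap.id + piS σ m)) ≃ₗ[R]
      ∀ i, A i m ⧸ LinearMap.range (LinearMap.id + σ i m) :=
  (Submodule.quotEquivOfEq _ _ (range_id_add_piS σ m)).trans (Submodule.quotientPi _)

end Product

/-! ## §B The split-prime extreme: the induced `Δ`-tower `B × B` with `σ` = swap

If a prime `w ∣ v` of `F_m` splits in `L_m`, its contribution to `U¹(L_m ⊗ ℚ₂)` is `U¹(F_{m,w}) × U¹(F_{m,w})`
with `σ` exchanging the two factors.  Everything the ladder needs is then FREE and EXACT: no located «×2».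
This is the boundary of R216 (for the class of record no `w ∣ v` splits); it is also the generic case at `𝔭`
in the two-variable tower. -/

section Swap

variable {R : Type u} [CommRing R]
variable {B : ℕ → Type v} [∀ m, AddCommGroup (B m)] [∀ m, Module R (B m)]
variable (t : ∀ m, B (m + 1) →ₗ[R] B m)

/-- Transitions of the induced tower: `t × t`. -/
def swapT (m : ℕ) : (B (m + 1) × B (m + 1)) →ₗ[R] (B m × B m) := (t m).prodMap (t m)

variable (R B) in
/-- The swap `σ (b₁, b₂) = (b₂, b₁)`. -/
def swapS (m : ℕ) : (B m × B m) →ₗ[R] (B m × B m) := (LinearEquiv.prodComm R (B m) (B m)).toLinearMap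

@[simp] theorem swapT_apply (m : ℕ) (a : B (m + 1) × B (m + 1)) : swapT t m a = (t m a.1, t m a.2) := rfl

@[simp] theorem swapS_apply (m : ℕ) (a : B m × B m) : swapS R B m a = (a.2, a.1) := rfl

/-- (INV) for free. -/
theorem swap_inv (m : ℕ) (a : B m × B m) : swapS R B m (swapS R B m a) = a := rfl

/-- (EQV) for free. -/
theorem swap_eqv (m : ℕ) (a : B (m + 1) × B (m + 1)) :
    swapT t m (swapS R B (m + 1) a) = swapS R B m (swapT t m a) := rfl

/-- `Ĥ⁻¹(Δ, B × B) = 0`: the anti-invariants ARE `(1 − σ)(B × B)` — no hypothesis. -/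
theorem swap_ker_id_add_eq_range_id_sub (m : ℕ) :
    LinearMap.ker (LinearMap.id + swapS R B m) = LinearMap.range (LinearMap.id - swapS R B m) := by
  ext a
  simp only [LinearMap.mem_ker, LinearMap.mem_range, LinearMap.add_apply, LinearMap.sub_apply,
    LinearMap.id_apply, swapS_apply]
  constructor
  · intro ha
    have h1 : a.1 + a.2 = 0 := by simpa using congr_arg Prod.fst ha
    refine ⟨(a.1, 0), ?_⟩
    have h2 : a.2 = -a.1 := eq_neg_of_add_eq_zero_right h1
    ext <;> simp [h2]
  · rintro ⟨b, rfl⟩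
    ext <;> simp

/-- `Ĥ⁰(Δ, B × B) = 0`: the `σ`-fixed elements ARE the `Δ`-norms — no hypothesis. -/
theorem swap_ker_id_sub_eq_range_id_add (m : ℕ) :
    LinearMap.ker (LinearMap.id - swapS R B m) = LinearMap.range (LinearMap.id + swapS R B m) := by
  ext a
  simp only [LinearMap.mem_ker, LinearMap.mem_range, LinearMap.add_apply, LinearMap.sub_apply,
    LinearMap.id_apply, swapS_apply]
  constructor
  · intro ha
    have h1 : a.1 = a.2 := sub_eq_zero.mp (by simpa using congr_arg Prod.fst ha)
    exact ⟨(a.1, 0), by ext <;> simp [h1]⟩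
  · rintro ⟨b, rfl⟩
    ext <;> simp <;> abel

/-- (PROBE) for free, with the explicit witness `(t a₁, 0)`. -/
theorem swap_probe (m : ℕ) (a : B (m + 1) × B (m + 1)) (ha : a + swapS R B (m + 1) a = 0) :
    ∃ b : B m × B m, b - swapS R B m b = swapT t m a := by
  have h1 : a.1 + a.2 = 0 := by simpa using congr_arg Prod.fst ha
  have h2 : a.2 = -a.1 := eq_neg_of_add_eq_zero_right h1
  exact ⟨(t m a.1, 0), by ext <;> simp [h2]⟩

/-- (F-ONTO) from `t` onto: a `σ`-fixed pair `(c, c)` lifts to the `σ`-fixed pair `(c', c')`. -/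
theorem swap_fonto (ht : ∀ m, Function.Surjective (t m)) (m : ℕ) (c : B m × B m)
    (hc : swapS R B m c = c) :
    ∃ c' : B (m + 1) × B (m + 1), swapS R B (m + 1) c' = c' ∧ swapT t m c' = c := by
  have h1 : c.2 = c.1 := by simpa using congr_arg Prod.fst hc
  obtain ⟨b, hb⟩ := ht m c.1
  exact ⟨(b, b), rfl, by ext <;> simp [hb, h1]⟩

/-- (N-ONTO) from `t` onto. -/
theorem swap_nonto (ht : ∀ m, Function.Surjective (t m)) (m : ℕ) : Function.Surjective (swapT t m) := by
  intro c
  obtain ⟨a, ha⟩ := ht m c.1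
  obtain ⟨b, hb⟩ := ht m c.2
  exact ⟨(a, b), by ext <;> simp [ha, hb]⟩

/-- **No located «×2» on a split factor, even in the limit**: every coherent `σ`-fixed sequence of the
induced tower is the `Δ`-norm of a COHERENT sequence (so the ladder's `ker coinvMap` vanishes there). -/
theorem swap_coherent_fixed_eq_norm (x : ∀ m, B m × B m)
    (hx : IsCoherent (A := fun m => B m × B m) (swapT t) x) (hfix : ∀ m, swapS R B m (x m) = x m) :
    ∃ z : ∀ m, B m × B m, IsCoherent (A := fun m => B m × B m) (swapT t) z ∧
      ∀ m, z m + swapS R B m (z m) = x m := by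
  refine ⟨fun m => ((x m).1, 0), ?_, ?_⟩
  · intro m
    have h1 : t m (x (m + 1)).1 = (x m).1 := by simpa using congr_arg Prod.fst (hx m)
    ext <;> simp [h1]
  · intro m
    have h1 : (x m).2 = (x m).1 := by simpa using congr_arg Prod.fst (hfix m)
    ext <;> simp [h1]

/-- The difference functional `(b₁, b₂) ↦ b₁ − b₂`. -/
def diffMap (m : ℕ) : (B m × B m) →ₗ[R] B m := LinearMap.fst R (B m) (B m) - LinearMap.snd R (B m) (B m)

@[simp] theorem diffMap_apply (m : ℕ) (a : B m × B m) : diffMap (R := R) (B := B) m a = a.1 - a.2 := rfl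

theorem diffMap_surjective (m : ℕ) : Function.Surjective (diffMap (R := R) (B := B) m) :=
  fun b => ⟨(b, 0), by simp⟩

theorem ker_diffMap (m : ℕ) :
    LinearMap.ker (diffMap (R := R) (B := B) m) = LinearMap.range (LinearMap.id + swapS R B m) := by
  rw [← swap_ker_id_sub_eq_range_id_add]
  ext a
  simp only [LinearMap.mem_ker, diffMap_apply, LinearMap.sub_apply, LinearMap.id_apply, swapS_apply]
  constructor
  · intro h
    have h1 : a.1 = a.2 := sub_eq_zero.mp h
    ext <;> simp [h1]
  · intro h
    simpa using congr_arg Prod.fst h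

/-- **One-level Shapiro on a split factor**: `(B × B)/(1+σ) ≃ₗ B` via `(b₁, b₂) ↦ b₁ − b₂`. -/
noncomputable def swapCoinvEquiv (m : ℕ) :
    ((B m × B m) ⧸ LinearMap.range (LinearMap.id + swapS R B m)) ≃ₗ[R] B m :=
  (Submodule.quotEquivOfEq _ _ (ker_diffMap (R := R) (B := B) m).symm).trans
    (LinearMap.quotKerEquivOfSurjective _ (diffMap_surjective (R := R) (B := B) m))

theorem swapCoinvEquiv_mk (m : ℕ) (a : B m × B m) :
    swapCoinvEquiv (R := R) (B := B) m (Submodule.Quotient.mk a) = a.1 - a.2 := by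
  simp [swapCoinvEquiv]

/-- Shapiro for the anti-invariants on a split factor: `ker(1+σ) ≃ₗ B` via the first coordinate. -/
def swapAntiEquiv (m : ℕ) : LinearMap.ker (LinearMap.id + swapS R B m) ≃ₗ[R] B m where
  toFun a := (a : B m × B m).1
  map_add' _ _ := rfl
  map_smul' _ _ := rfl
  invFun b := ⟨(b, -b), by simp⟩
  left_inv a := by
    apply Subtype.ext
    have h0 : (a : B m × B m) + swapS R B m a = 0 := a.2
    have h1 : (a : B m × B m).1 + (a : B m × B m).2 = 0 := by simpa using congr_arg Prod.fst h0
    have h2 : (a : B m × B m).2 = -(a : B m × B m).1 := eq_neg_of_add_eq_zero_right h1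
    ext <;> simp [h2]
  right_inv _ := rfl

/-- Under the two Shapiro isomorphisms the integral comparison `1 − σ : (B×B)/(1+σ) → ker(1+σ)` reads as
the IDENTITY of `B` (both sides send `(b₁, b₂)` to `b₁ − b₂`): on a split factor (LOWER) is an isomorphism
with no cokernel and no kernel. -/
theorem swap_one_sub_reads_identity (m : ℕ) (a : B m × B m)
    (h : a - swapS R B m a ∈ LinearMap.ker (LinearMap.id + swapS R B m)) :
    swapAntiEquiv (R := R) (B := B) m ⟨a - swapS R B m a, h⟩ =
      swapCoinvEquiv (R := R) (B := B) m (Submodule.Quotient.mk a) := by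
  rw [swapCoinvEquiv_mk]
  rfl

theorem sub_swap_mem_ker (m : ℕ) (a : B m × B m) :
    a - swapS R B m a ∈ LinearMap.ker (LinearMap.id + swapS R B m) := by
  rw [swap_ker_id_add_eq_range_id_sub]
  exact ⟨a, rfl⟩

end Swap

/-! ## §D Transport along levelwise `σ, t`-compatible isomorphisms

The typer identifies the abstract tower with the tree's carriers through `Semilocal.piEquiv` / `unitsEquiv`
(`SemilocalPrincipalUnitsPi.lean`) and `Additive`; the ladder hypotheses and the limit move along. -/

section Transport

variable {R : Type u} [CommRing R]
variable {A : ℕ → Type v} [∀ m, AddCommGroup (A m)] [∀ m, Module R (A m)]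
variable {A' : ℕ → Type w} [∀ m, AddCommGroup (A' m)] [∀ m, Module R (A' m)]
variable (t : ∀ m, A (m + 1) →ₗ[R] A m) (σ : ∀ m, A m →ₗ[R] A m)
variable (t' : ∀ m, A' (m + 1) →ₗ[R] A' m) (σ' : ∀ m, A' m →ₗ[R] A' m)
variable (e : ∀ m, A m ≃ₗ[R] A' m)

theorem transport_inv (hσ : ∀ m a, e m (σ m a) = σ' m (e m a)) (h : ∀ m a, σ m (σ m a) = a)
    (m : ℕ) (a' : A' m) : σ' m (σ' m a') = a' := by
  obtain ⟨a, rfl⟩ := (e m).surjective a'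
  rw [← hσ, ← hσ, h]

theorem transport_eqv (ht : ∀ m a, e m (t m a) = t' m (e (m + 1) a))
    (hσ : ∀ m a, e m (σ m a) = σ' m (e m a)) (h : ∀ m a, t m (σ (m + 1) a) = σ m (t m a))
    (m : ℕ) (a' : A' (m + 1)) : t' m (σ' (m + 1) a') = σ' m (t' m a') := by
  obtain ⟨a, rfl⟩ := (e (m + 1)).surjective a'
  rw [← hσ, ← ht, h, hσ, ht]

theorem transport_probe (ht : ∀ m a, e m (t m a) = t' m (e (m + 1) a))
    (hσ : ∀ m a, e m (σ m a) = σ' m (e m a))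
    (h : ∀ m (a : A (m + 1)), a + σ (m + 1) a = 0 → ∃ b : A m, b - σ m b = t m a)
    (m : ℕ) (a' : A' (m + 1)) (ha' : a' + σ' (m + 1) a' = 0) :
    ∃ b' : A' m, b' - σ' m b' = t' m a' := by
  obtain ⟨a, rfl⟩ := (e (m + 1)).surjective a'
  have ha : a + σ (m + 1) a = 0 := by
    apply (e (m + 1)).injective
    rw [map_add, hσ, ha', map_zero]
  obtain ⟨b, hb⟩ := h m a ha
  exact ⟨e m b, by rw [← hσ, ← map_sub, hb, ht]⟩

theorem transport_fonto (ht : ∀ m a, e m (t m a) = t' m (e (m + 1) a))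
    (hσ : ∀ m a, e m (σ m a) = σ' m (e m a))
    (h : ∀ m (c : A m), σ m c = c → ∃ c' : A (m + 1), σ (m + 1) c' = c' ∧ t m c' = c)
    (m : ℕ) (d : A' m) (hd : σ' m d = d) :
    ∃ d' : A' (m + 1), σ' (m + 1) d' = d' ∧ t' m d' = d := by
  obtain ⟨c, rfl⟩ := (e m).surjective d
  have hc : σ m c = c := by
    apply (e m).injective
    rw [hσ, hd]
  obtain ⟨c', h1, h2⟩ := h m c hc
  exact ⟨e (m + 1) c', by rw [← hσ, h1], by rw [← ht, h2]⟩

theorem transport_nonto (ht : ∀ m a, e m (t m a) = t' m (e (m + 1) a))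
    (h : ∀ m, Function.Surjective (t m)) (m : ℕ) : Function.Surjective (t' m) := by
  intro d
  obtain ⟨c, rfl⟩ := (e m).surjective d
  obtain ⟨a, rfl⟩ := h m c
  exact ⟨e (m + 1) a, (ht m a).symm⟩

/-- The limits along a `t`-compatible levelwise isomorphism. -/
def invLimCongr (ht : ∀ m a, e m (t m a) = t' m (e (m + 1) a)) : invLim t ≃ₗ[R] invLim t' where
  toFun x := ⟨fun m => e m ((x : ∀ m, A m) m), fun m => by
    show t' m (e (m + 1) ((x : ∀ m, A m) (m + 1))) = e m ((x : ∀ m, A m) m)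
    rw [← ht, coherent_of_mem x m]⟩
  map_add' x y := by
    apply Subtype.ext
    funext m
    simp only [Submodule.coe_add, Pi.add_apply, map_add]
  map_smul' c x := by
    apply Subtype.ext
    funext m
    simp only [Submodule.coe_smul, Pi.smul_apply, map_smul, RingHom.id_apply]
  invFun y := ⟨fun m => (e m).symm ((y : ∀ m, A' m) m), fun m => by
    show t m ((e (m + 1)).symm ((y : ∀ m, A' m) (m + 1))) = (e m).symm ((y : ∀ m, A' m) m)
    apply (e m).injective
    rw [ht, LinearEquiv.apply_symm_apply, LinearEquiv.apply_symm_apply, coherent_of_mem y m]⟩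
  left_inv x := by
    apply Subtype.ext
    funext m
    exact (e m).symm_apply_apply _
  right_inv y := by
    apply Subtype.ext
    funext m
    exact (e m).apply_symm_apply _

@[simp] theorem invLimCongr_apply (ht : ∀ m a, e m (t m a) = t' m (e (m + 1) a)) (x : invLim t) (m : ℕ) :
    (invLimCongr t t' e ht x : ∀ m, A' m) m = e m ((x : ∀ m, A m) m) := rfl

end Transport

/-! ## §E `Coinv χ_u = COINV`: a group acting through `Δ = {1, σ}`

The tree's `SemilocalUnitData₂.coinvRel χ := span {act υ m − χ υ • m | υ ∈ Υ}` for the even-character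
group `Υ`; on the `v`-part of record `Υ` acts through the decomposition group `Δ = Gal(L/F) = {1, σ}` and
`χ_u` is `−1` exactly on the elements acting as `σ`.  Then the relation module is `range (σ + 1)`, i.e.
`Coinv χ_u = A/(σ+1)A = COINV` of the one-operator ladder (`span_coinvRel_eq_range` of k3-g35 is the case
`Υ = {σ}`).  The second lemma is the located FAILURE MODE of the dictionary. -/

section CoinvRel

variable {R : Type u} [CommRing R] {M : Type v} [AddCommGroup M] [Module R M]
variable {Υ : Type w} (act : Υ → M →ₗ[R] M) (χ : Υ → R)

/-- The relation module of `χ`-coinvariants (shape of the tree's `SemilocalUnitData₂.coinvRel`). -/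
def coinvRel : Submodule R M := Submodule.span R {x | ∃ υ m, x = act υ m - χ υ • m}

/-- If `Υ` acts through `{1, σ}` and `χ = −1` exactly on the elements acting as `σ` (and some element does),
the `χ`-coinvariant relations are exactly `(σ + 1)M`. -/
theorem coinvRel_eq_range_of_through (σ : M →ₗ[R] M)
    (hgen : ∀ υ, (act υ = σ ∧ χ υ = -1) ∨ (act υ = LinearMap.id ∧ χ υ = 1))
    (hne : ∃ υ, act υ = σ ∧ χ υ = -1) :
    coinvRel act χ = LinearMap.range (σ + LinearMap.id) := by
  apply le_antisymm
  · apply Submodule.span_le.mpr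
    rintro x ⟨υ, m, rfl⟩
    rcases hgen υ with ⟨h1, h2⟩ | ⟨h1, h2⟩
    · exact ⟨m, by simp [h1, h2]⟩
    · simp [h1, h2]
  · rintro x ⟨m, rfl⟩
    obtain ⟨υ, h1, h2⟩ := hne
    exact Submodule.subset_span ⟨υ, m, by simp [h1, h2]⟩

/-- FAILURE MODE (cheapest falsifier of the dictionary): an element acting TRIVIALLY but labelled
`χ υ = −1` contributes the relation `2m` — the quotient would acquire spurious `2`-torsion relations. -/
theorem two_smul_mem_coinvRel_of_mislabel (υ : Υ) (h1 : act υ = LinearMap.id) (h2 : χ υ = -1) (m : M) :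
    (2 : R) • m ∈ coinvRel act χ := by
  refine Submodule.subset_span ⟨υ, m, ?_⟩
  rw [h1, h2, LinearMap.id_apply, neg_smul, one_smul, sub_neg_eq_add, two_smul]

end CoinvRel

/-! ## §F Shapiro for the digit: the induced functional on `Π_{w ∣ v} M`

The `(2)₂` digit is read through a class-free predicate on a functional (`LowerDigit'`, k1-g33 / P30,
restated verbatim).  The semi-local functional on the `v`-part is the INDUCED one,
`L_ind (a) = Σ_w L (c_w (a_w))` with `c_w` the conjugation isomorphisms between the completions; its digit
is the digit of `L` — over the same scalar ring (the passage `Λ_Γ ⇝ Λ_D` of de Shalit III.1.3, «Λ free over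
Λ_z», is NOT covered here and is flagged on the card). -/

section Digit

variable {R : Type u} [CommRing R]
variable {M : Type v} [AddCommGroup M] [Module R M]
variable {N : Type w} [AddCommGroup N] [Module R N]

/-- k1-g33's class-free digit predicate, as in `ReceptacleLadderK3G35.LowerDigit'` (port imports P30):
every scalar factorisation `L = r • h` has `r ∣ 2`. -/
def LowerDigit' (L : M →ₗ[R] N) : Prop := ∀ (r : R) (h : M →ₗ[R] N), L = r • h → r ∣ (2 : R)

/-- The digit is invariant under precomposition with a linear ISOMORPHISM (conjugation between completions,
`Semilocal.piEquiv`, the cofinal shift, …). -/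
theorem lowerDigit'_comp_equiv_iff {M' : Type*} [AddCommGroup M'] [Module R M'] (L : M →ₗ[R] N)
    (e : M' ≃ₗ[R] M) : LowerDigit' (L ∘ₗ e.toLinearMap) ↔ LowerDigit' L := by
  constructor
  · intro hd r h hL
    exact hd r (h ∘ₗ e.toLinearMap) (by rw [hL, LinearMap.smul_comp])
  · intro hd r h' hL
    refine hd r (h' ∘ₗ e.symm.toLinearMap) ?_
    rw [← LinearMap.smul_comp, ← hL, LinearMap.comp_assoc, LinearEquiv.comp_coe,
      LinearEquiv.symm_trans_self, LinearEquiv.refl_toLinearMap, LinearMap.comp_id]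

variable {ι : Type*} [Fintype ι]

/-- The induced functional `a ↦ Σ_i L (c_i (a_i))` on `Π_i M`. -/
def indFun (L : M →ₗ[R] N) (c : ι → (M ≃ₗ[R] M)) : (ι → M) →ₗ[R] N :=
  ∑ i, (L ∘ₗ (c i).toLinearMap) ∘ₗ LinearMap.proj i

theorem indFun_apply (L : M →ₗ[R] N) (c : ι → (M ≃ₗ[R] M)) (a : ι → M) :
    indFun L c a = ∑ i, L (c i (a i)) := by
  simp [indFun]

theorem indFun_smul (r : R) (h : M →ₗ[R] N) (c : ι → (M ≃ₗ[R] M)) :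
    indFun (r • h) c = r • indFun h c := by
  simp only [indFun, LinearMap.smul_comp, Finset.smul_sum]

theorem indFun_single [DecidableEq ι] (L : M →ₗ[R] N) (c : ι → (M ≃ₗ[R] M)) (i₀ : ι) (m : M) :
    indFun L c (Pi.single i₀ m) = L (c i₀ m) := by
  rw [indFun_apply, Finset.sum_eq_single i₀]
  · rw [Pi.single_eq_same]
  · intro i _ hi
    rw [Pi.single_eq_of_ne hi, map_zero, map_zero]
  · intro h
    exact absurd (Finset.mem_univ i₀) h

theorem indFun_comp_single [DecidableEq ι] (L : M →ₗ[R] N) (c : ι → (M ≃ₗ[R] M)) (i₀ : ι) :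
    indFun L c ∘ₗ LinearMap.single R (fun _ : ι => M) i₀ = L ∘ₗ (c i₀).toLinearMap := by
  ext m
  simp only [LinearMap.comp_apply, LinearMap.coe_single, indFun_single, LinearEquiv.coe_coe]

/-- The digit of `L` bounds the digit of the induced functional (no index needed). -/
theorem lowerDigit'_of_indFun (L : M →ₗ[R] N) (c : ι → (M ≃ₗ[R] M)) (hd : LowerDigit' (indFun L c)) :
    LowerDigit' L := by
  intro r h hL
  exact hd r (indFun h c) (by rw [hL, indFun_smul])

/-- Conversely, with at least one factor, the digit of the induced functional is that of `L`. -/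
theorem lowerDigit'_indFun_of [DecidableEq ι] (i₀ : ι) (L : M →ₗ[R] N) (c : ι → (M ≃ₗ[R] M))
    (hd : LowerDigit' L) : LowerDigit' (indFun L c) := by
  intro r H hH
  have hd' : LowerDigit' (L ∘ₗ (c i₀).toLinearMap) := (lowerDigit'_comp_equiv_iff L (c i₀)).mpr hd
  refine hd' r (H ∘ₗ LinearMap.single R (fun _ : ι => M) i₀) ?_
  rw [← indFun_comp_single, hH, LinearMap.smul_comp]

/-- **SHAPIRO FOR THE DIGIT.**  `LowerDigit' L_ind ↔ LowerDigit' L` (same scalar ring). -/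
theorem lowerDigit'_indFun_iff [DecidableEq ι] (i₀ : ι) (L : M →ₗ[R] N) (c : ι → (M ≃ₗ[R] M)) :
    LowerDigit' (indFun L c) ↔ LowerDigit' L :=
  ⟨lowerDigit'_of_indFun L c, lowerDigit'_indFun_of i₀ L c⟩

end Digit

/-! ## §G The elliptic-units snake step (critic (γ)): passing the comparison to `U_∞/𝒞_∞`

The tree's pinned datum `SemilocalUnitData₂` carries `M = U_∞/𝒞_∞`.  The ladder is run on `U_∞` (where the
local hypotheses live) and THEN the quotient is taken: right exactness of coinvariants plus the ladder's
located `2`-torsion give the comparison on the quotient with the same bound.  INPUTS AS HYPOTHESES (never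
re-derived here, K46): `g` onto = `range_coinvMap_eq`/`range_limMinus_eq`; `2 · ker g ≤ D` =
`two_smul_ker_coinvMap`; `K` = the image of `lim 𝒞̄` (norm-coherence of elliptic units, de Shalit II.2.5 (i),
enters only through `lim U ↠ lim U/𝒞̄` = k3-g35 `limMap_surjective` shape / tree `exists_normCoherent_reps`). -/

section Snake

variable {R : Type u} [CommRing R]
variable {P : Type v} [AddCommGroup P] [Module R P]
variable {E : Type w} [AddCommGroup E] [Module R E]
variable (g : P →ₗ[R] E) (D K : Submodule R P)

theorem sup_le_ker_mkQ_comp (hD : D ≤ LinearMap.ker g) :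
    D ⊔ K ≤ LinearMap.ker ((K.map g).mkQ ∘ₗ g) := by
  rw [LinearMap.ker_comp, Submodule.ker_mkQ]
  refine sup_le (fun p hp => ?_) (fun p hp => ?_)
  · rw [Submodule.mem_comap, LinearMap.mem_ker.mp (hD hp)]
    exact Submodule.zero_mem _
  · exact Submodule.mem_comap.mpr (Submodule.mem_map_of_mem hp)

/-- The comparison induced on the quotients: `P/(D ⊔ K) → E/g(K)`. -/
def snakeMap (hD : D ≤ LinearMap.ker g) : (P ⧸ (D ⊔ K)) →ₗ[R] (E ⧸ K.map g) :=
  (D ⊔ K).liftQ ((K.map g).mkQ ∘ₗ g) (sup_le_ker_mkQ_comp g D K hD)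

@[simp] theorem snakeMap_mk (hD : D ≤ LinearMap.ker g) (p : P) :
    snakeMap g D K hD (Submodule.Quotient.mk p) = Submodule.Quotient.mk (g p) := rfl

/-- Right exactness: the induced comparison is onto when `g` is. -/
theorem snakeMap_surjective (hD : D ≤ LinearMap.ker g) (hg : Function.Surjective g) :
    Function.Surjective (snakeMap g D K hD) := by
  intro q
  obtain ⟨e, rfl⟩ := Submodule.Quotient.mk_surjective _ q
  obtain ⟨p, rfl⟩ := hg e
  exact ⟨Submodule.Quotient.mk p, rfl⟩

/-- **The snake step**: if the kernel of `g` is killed by `2` INTO `D` (the ladder's located `2`-torsion),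
the kernel of the induced comparison on the quotients is killed by `2` — whatever `K` is. -/
theorem two_smul_ker_snakeMap (hD : D ≤ LinearMap.ker g) (h2 : ∀ p ∈ LinearMap.ker g, (2 : R) • p ∈ D)
    (q : P ⧸ (D ⊔ K)) (hq : q ∈ LinearMap.ker (snakeMap g D K hD)) : (2 : R) • q = 0 := by
  obtain ⟨p, rfl⟩ := Submodule.Quotient.mk_surjective _ q
  rw [LinearMap.mem_ker, snakeMap_mk, Submodule.Quotient.mk_eq_zero, Submodule.mem_map] at hq
  obtain ⟨k, hk, hgk⟩ := hq
  have hker : p - k ∈ LinearMap.ker g := by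
    rw [LinearMap.mem_ker, map_sub, hgk, sub_self]
  rw [← Submodule.Quotient.mk_smul, Submodule.Quotient.mk_eq_zero]
  have hsplit : (2 : R) • p = (2 : R) • (p - k) + (2 : R) • k := by rw [smul_sub, sub_add_cancel]
  rw [hsplit]
  exact Submodule.add_mem_sup (h2 _ hker) (Submodule.smul_mem _ _ hk)

/-- The induced operator on `P/K` for a `K`-stable `σ`, and its `Δ`-norm image: `(1+σ̄)(P/K)` is the image
of `(1+σ)P`. -/
theorem range_id_add_mapQ (σ : P →ₗ[R] P) (hK : K ≤ K.comap σ) (hK' : K ≤ K.comap (LinearMap.id + σ)) :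
    LinearMap.range (LinearMap.id + K.mapQ K σ hK) = (LinearMap.range (LinearMap.id + σ)).map K.mkQ := by
  have hmaps : LinearMap.id + K.mapQ K σ hK = K.mapQ K (LinearMap.id + σ) hK' := by
    apply LinearMap.ext
    intro q
    obtain ⟨p, rfl⟩ := Submodule.Quotient.mk_surjective _ q
    rfl
  rw [hmaps]
  apply le_antisymm
  · rintro _ ⟨q, rfl⟩
    obtain ⟨p, rfl⟩ := Submodule.Quotient.mk_surjective K q
    exact ⟨p + σ p, LinearMap.mem_range_self (LinearMap.id + σ : P →ₗ[R] P) p, rfl⟩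
  · rintro _ ⟨_, ⟨p, rfl⟩, rfl⟩
    exact ⟨Submodule.Quotient.mk p, rfl⟩

theorem le_comap_id_add (σ : P →ₗ[R] P) (hK : K ≤ K.comap σ) : K ≤ K.comap (LinearMap.id + σ) := by
  intro k hk
  rw [Submodule.mem_comap, LinearMap.add_apply, LinearMap.id_apply]
  exact K.add_mem hk (hK hk)

/-- **Coinvariants of the quotient tower** `(P/K)/(1+σ̄) ≃ₗ P/(K ⊔ (1+σ)P)`: the receptacle of (LOWER) on
`U_∞/𝒞_∞` is the receptacle on `U_∞` modulo the image of the elliptic units — the target of `snakeMap`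
with `D = (1+σ)P` (after `sup_comm`). -/
noncomputable def coinvQuotEquiv (σ : P →ₗ[R] P) (hK : K ≤ K.comap σ) :
    ((P ⧸ K) ⧸ LinearMap.range (LinearMap.id + K.mapQ K σ hK)) ≃ₗ[R]
      P ⧸ (K ⊔ LinearMap.range (LinearMap.id + σ)) :=
  (Submodule.quotEquivOfEq _ _ (range_id_add_mapQ K σ hK (le_comap_id_add K σ hK))).trans
    (Submodule.quotientQuotientEquivQuotientSup K (LinearMap.range (LinearMap.id + σ)))

end Snake

end Summit.BirchSwinnertonDyer.BirchSwinnertonDyer.Cruxes.SplitBadTwoLowerHalfOfFacts.ShapiroVDictionaryK3G36
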